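import Summits.ResolutionOfSingularities.ResolutionOfSingularities.Theorems.FloorDescent2
import Summits.ResolutionOfSingularities.ResolutionOfSingularities.Theorems.FloorCutClasses
import Summits.ResolutionOfSingularities.ResolutionOfSingularities.Theorems.MaxContactCutFloorCut
import Literature.AlgebraicGeometry.Resolution.PointBlowupFlagTranslatedStep
import HarnessLib

/-!
# FloorDescent (3/6) — §5 (L1) `translate_chartTransform` + THE LIFT LAW `lift_law` (moved here, see below) · §6
(L4) THE ISOLATION LAW `isolation_law` (arc ideal, `topIdeal_le_arcIdeal`, transport
`topIdeal_map_le`)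

Part of the node «FloorDescent» (decomp-res · lens-5 g34): the ORDER FLOOR cell `FloorCut.NoFloorTailsDeep` of the deep
tight-defect column DECIDED IN KERNEL for every prime `p` and exponent `e` (statement, mechanism and honest placement in
the module docstring of `FloorDescent6`; record HOME/decomp-res-lens-5/g34/NODE-g34.md).  Verbatim slice of the farm-checked
monolith `HOME/decomp-res-lens-5/g34/FloorDescent.lean` (lines 685–927); one namespace across the six slices.
-/

open MvPolynomial Finset
open scoped BigOperators Polynomial
open Literature.AlgebraicGeometry.Resolution
open Literature.AlgebraicGeometry.Resolution.Hauser2010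
open Literature.AlgebraicGeometry.Resolution.PointBlowup
open Literature.AlgebraicGeometry.Resolution.HauserPerlega2024
open Summit.ResolutionOfSingularities.ResolutionOfSingularities.Theorems.TightDefectClasses

namespace Summit.ResolutionOfSingularities.ResolutionOfSingularities.Theorems.FloorDescent

noncomputable section

/-! ## §5 (L1), continued from `FloorDescent1`/`FloorDescent2` — the shear factorisation `translate_chartTransform`
and THE LIFT LAW
`lift_law`, MOVED HERE UNCHANGED by the writer (decomp-res writer g13): after the tree lint pass (docstrings on
every theorem) the
lens's slice 2 exceeded the 400-line cap; `section Lift` and its `variable` line are replayed. -/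

section Lift

variable {σ : Type} [DecidableEq σ] [Fintype σ] {K : Type} [Field K]

/-- **The point transform is the `y_j`-chart of the SHEARED polynomial** (`b_j = 0`, `ord F ≥ q`):
`τ_b(chart_j F) = chart_j(shear_b F)`. (Sources: HauserPerlega2024, §4 p. 779 (shear factorisation, general σ).) -/
theorem translate_chartTransform (q : ℕ) (j : σ) (b : σ → K) (hbj : b j = 0) {F : MvPolynomial σ K}
    (hF : OrdGE q F) : PointBlowup.translate b (chartTransform q j F) = chartTransform q j (frame j (shearArc b) F) := by
  have hF' : OrdGE q (frame j (shearArc b) F) := hF.frame j _ (shearArc_coeff_zero b)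
  have h1 : X j ^ q * PointBlowup.translate b (chartTransform q j F)
      = X j ^ q * chartTransform q j (frame j (shearArc b) F) := by
    rw [X_pow_mul_chartTransform q j hF', ← translate_coneMap j b hbj, ← X_pow_mul_chartTransform q j hF]
    have hX : PointBlowup.translate b (X j ^ q : MvPolynomial σ K) = X j ^ q := by
      rw [PointBlowup.translate, map_pow, MvPolynomial.aeval_X, hbj, C_0, add_zero]
    conv_rhs => rw [PointBlowup.translate, map_mul, ← PointBlowup.translate, ← PointBlowup.translate, hX]
  exact mul_left_cancel₀ (pow_ne_zero q (X_ne_zero j)) h1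

/-- **(L1) THE LIFT LAW, walk form.**  At a floor step with centre `(j, b)` (`b_j = 0`, `ord F ≥ q`): if some
`j`-based frame `frame_j(r)` puts the NEXT equation `F' = clean(τ_b chart_j F)` in arc condition of depth `m`,
then the `j`-based frame of the arc `y_i = b_i y_j + y_j r_i(y_j)` puts `F` itself in arc condition of depth
`m + 1`.  CONSUMES: `ord F_t ≥ q`, `b_t(j_t) = 0` (`onExc`), the step law `F_{t+1} = clean(pointTransform)`;
NOT the floor, NOT isolation. [folklore] -/
theorem lift_law {p : ℕ} [Fact p.Prime] [CharP K p] (e : ℕ) (j : σ) (b : σ → K) (hbj : b j = 0)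
    {F : MvPolynomial σ K} (hF : OrdGE (p ^ e) F) (r : σ → K[X]) {m : ℕ}
    (harc : ArcCond j (p ^ e) m
      (frame j r (deletePthPowers (p ^ e) (PointBlowup.translate b (chartTransform (p ^ e) j F))))) :
    ArcCond j (p ^ e) (m + 1) (frame j (fun i => shearArc b i + Polynomial.X * r i) F) := by
  set q := p ^ e with hq
  set Φ := frame j (shearArc b) F with hΦ
  have hΦord : OrdGE q Φ := hF.frame j _ (shearArc_coeff_zero b)
  rw [translate_chartTransform q j b hbj hF] at harc
  -- remove the cleaning: the deleted part is a `q`-power polynomial, and so is its frame image (Frobenius)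
  have harc' : ArcCond j q m (frame j r (chartTransform q j Φ)) := by
    have hQ : IsQPow q (frame j r (chartTransform q j Φ - deletePthPowers q (chartTransform q j Φ))) :=
      (isQPow_sub_deletePthPowers q _).map_algHom _
    have := harc.add (hQ.arcCond (j := j) (m := m))
    rwa [← map_add, add_sub_cancel] at this
  refine arcCond_succ_of_cone (hF.frame j _ fun i => by simp [shearArc]) harc' ?_
  have hfun : ((fun i => Polynomial.X * r i) + shearArc b) = fun i => shearArc b i + Polynomial.X * r i := by
    funext i; simp only [Pi.add_apply]; ring
  rw [← frame_X_pow_self j r q, ← map_mul, X_pow_mul_chartTransform q j hΦord, ← coneMap_frame_X_mul, hΦ,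
    frame_frame, hfun]

end Lift

/-! ## §6 (L4) THE ISOLATION LAW — `ArcCond m` puts every Hasse derivative of order `< q` into the arc ideal
`(y_j^m, y_i : i ≠ j)`; transported back through the frame, an ISOLATED top locus forbids this for `m` large. -/

section Isolation

variable {σ : Type} [DecidableEq σ] [Fintype σ] {K : Type} [Field K]

omit [DecidableEq σ] [Fintype σ] in
/-- `taylor f − C f` has no constant term in the increment variables. [folklore] -/
theorem taylor_sub_C_mem_idealOfVars (H : MvPolynomial σ K) :
    taylor K H - C H ∈ idealOfVars σ (MvPolynomial σ K) := by
  rw [← pow_one (idealOfVars σ (MvPolynomial σ K)), mem_pow_idealOfVars_iff']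
  intro x hx
  have hx0 : x = 0 := by rwa [Nat.lt_one_iff, Finsupp.degree_eq_zero_iff] at hx
  subst hx0
  rw [coeff_sub, ← hasseDeriv_apply, hasseDeriv_zero_apply, coeff_zero_C, sub_self]

/-- A product of powers of elements of an ideal lies in the corresponding power. [folklore] -/
theorem prod_pow_mem_pow {R : Type} [CommRing R] {ι : Type} (I : Ideal R) (s : Finset ι) (f : ι → R) (n : ι → ℕ)
    (h : ∀ i ∈ s, f i ∈ I) : ∏ i ∈ s, f i ^ n i ∈ I ^ ∑ i ∈ s, n i := by
  classical
  induction s using Finset.induction_on with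
  | empty => simp
  | insert a s ha ih =>
    rw [Finset.prod_insert ha, Finset.sum_insert ha, pow_add]
    exact Ideal.mul_mem_mul (Ideal.pow_mem_pow (h a (Finset.mem_insert_self a s)) _)
      (ih fun i hi => h i (Finset.mem_insert_of_mem hi))

omit [Fintype σ] in
/-- **Frobenius kills low Hasse derivatives of `q`-th powers**: `coeff_δ taylor(H^q) = 0` for `0 < |δ| < q`,
since `taylor(H)^q = (C H + Δ)^q = C(H^q) + Δ^q` with `Δ ∈ (u)`. [folklore] -/
theorem coeff_taylor_pow_eq_zero {p : ℕ} [Fact p.Prime] [CharP K p] (e : ℕ) (H : MvPolynomial σ K)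
    {δ : σ →₀ ℕ} (hδ0 : δ ≠ 0) (hδ : δ.degree < p ^ e) : coeff δ (taylor K (H ^ p ^ e)) = 0 := by
  have hT : taylor K H = C H + (taylor K H - C H) := by ring
  rw [map_pow, hT, add_pow_char_pow, ← map_pow, coeff_add, coeff_C, if_neg (Ne.symm hδ0), zero_add]
  have := Ideal.pow_mem_pow (taylor_sub_C_mem_idealOfVars (σ := σ) H) (p ^ e)
  rw [mem_pow_idealOfVars_iff'] at this
  exact this δ hδ

omit [Fintype σ] in
/-- **Hasse derivatives of order `< q` of a `q`-power polynomial vanish.** [folklore] -/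
theorem hasseDeriv_eq_zero_of_isQPow {p : ℕ} [Fact p.Prime] [CharP K p] {e : ℕ} {G : MvPolynomial σ K}
    (hG : IsQPow (p ^ e) G) {δ : σ →₀ ℕ} (hδ0 : δ ≠ 0) (hδ : δ.degree < p ^ e) : hasseDeriv K δ G = 0 := by
  have hq : 0 < p ^ e := pow_pos (Fact.out : p.Prime).pos e
  rw [G.as_sum, map_sum]
  refine Finset.sum_eq_zero fun d hd => ?_
  have hd' : ∀ i, p ^ e ∣ d i := (isPthPowerExponent_iff _ _).mp (hG d hd)
  set a := Finsupp.mapRange (fun n => n / p ^ e) (Nat.zero_div (p ^ e)) d with ha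
  have hmon : (monomial d (coeff d G) : MvPolynomial σ K) = coeff d G • (monomial a 1) ^ p ^ e := by
    rw [monomial_pow, one_pow, ← eq_smul_div_of_dvd hq hd', smul_monomial, smul_eq_mul, mul_one]
  rw [hmon, map_smul, hasseDeriv_apply, coeff_taylor_pow_eq_zero e _ hδ0 hδ, smul_zero]

/-- The ARC IDEAL `(y_j^m, y_i : i ≠ j)` — functions vanishing to order `m` along the `y_j`-axis.
[folklore] -/
def arcIdeal (j : σ) (m : ℕ) : Ideal (MvPolynomial σ K) :=
  Ideal.span (insert (X j ^ m) ((fun i => (X i : MvPolynomial σ K)) '' {i | i ≠ j}))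

omit [DecidableEq σ] [Fintype σ] in
/-- `X_pow_mem_arcIdeal`: Auxiliary step of this node's calculus, VERBATIM from the lens file (see the module
docstring); the statement is its type. [folklore] -/
theorem X_pow_mem_arcIdeal (j : σ) (m : ℕ) : (X j ^ m : MvPolynomial σ K) ∈ arcIdeal j m :=
  Ideal.subset_span (Set.mem_insert _ _)

omit [DecidableEq σ] [Fintype σ] in
/-- `X_mem_arcIdeal`: Auxiliary step of this node's calculus, VERBATIM from the lens file (see the module
docstring); the statement is its type. [folklore] -/
theorem X_mem_arcIdeal (j : σ) (m : ℕ) {i : σ} (hij : i ≠ j) : (X i : MvPolynomial σ K) ∈ arcIdeal j m :=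
  Ideal.subset_span (Set.mem_insert_of_mem _ ⟨i, hij, rfl⟩)

/-- **An ARC monomial has all its low Hasse derivatives in the arc ideal**: if `m (q − |d|_{≠j}) ≤ d_j` then
`D^{(δ)} y^d ∈ (y_j^m, y_i : i ≠ j)` for `|δ| < q` (read `taylor(y^d)` modulo the arc ideal: only
`(C ȳ_j + u_j)^{d_j} ∏ u_i^{d_i}` survives, and its `u`-order is `≥ q`). [folklore] -/
theorem hasseDeriv_monomial_mem_arcIdeal (j : σ) {q m : ℕ} {d : σ →₀ ℕ} (hd : m * (q - offDeg j d) ≤ d j)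
    (c : K) {δ : σ →₀ ℕ} (hδ : δ.degree < q) :
    hasseDeriv K δ (monomial d c) ∈ (arcIdeal j m : Ideal (MvPolynomial σ K)) := by
  set 𝔞 : Ideal (MvPolynomial σ K) := arcIdeal j m with h𝔞
  set R := MvPolynomial σ K ⧸ 𝔞 with hR
  set mk : MvPolynomial σ K →+* R := Ideal.Quotient.mk 𝔞 with hmk
  set 𝔪 : Ideal (MvPolynomial σ R) := idealOfVars σ R with h𝔪
  -- the image of `taylor (y^d)` modulo the arc ideal
  have hmon : (monomial d c : MvPolynomial σ K) = C c * ∏ i, X i ^ d i := by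
    rw [monomial_eq, Finsupp.prod_fintype _ _ (fun i => pow_zero _)]
  have hT : MvPolynomial.map mk (taylor K (monomial d c))
      = C (mk (C c)) * ((C (mk (X j)) + X j) ^ d j * ∏ i ∈ univ.erase j, (X i : MvPolynomial σ R) ^ d i) := by
    rw [hmon, map_mul, taylor_C, map_prod, map_mul, map_C, map_prod, ← Finset.mul_prod_erase _ _ (mem_univ j)]
    congr 2
    · rw [map_pow, taylor_X, map_pow, map_add, map_C, map_X]
    · refine Finset.prod_congr rfl fun i hi => ?_
      have h0 : mk (X i) = 0 := Ideal.Quotient.eq_zero_iff_mem.mpr (X_mem_arcIdeal j m (ne_of_mem_erase hi))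
      rw [map_pow, taylor_X, map_pow, map_add, map_C, map_X, h0, C_0, zero_add]
  -- it lies in `𝔪^q`
  have hXmem : ∀ i, (X i : MvPolynomial σ R) ∈ 𝔪 := fun i => Ideal.subset_span (Set.mem_range_self i)
  have h2 : ∏ i ∈ univ.erase j, (X i : MvPolynomial σ R) ^ d i ∈ 𝔪 ^ offDeg j d := by
    unfold offDeg
    exact prod_pow_mem_pow 𝔪 (univ.erase j) (fun i => (X i : MvPolynomial σ R)) (fun i => d i) fun i _ => hXmem i
  have hyj : mk (X j) ^ m = 0 := by
    rw [← map_pow]; exact Ideal.Quotient.eq_zero_iff_mem.mpr (X_pow_mem_arcIdeal j m)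
  have h3 : ((C (mk (X j)) + X j) ^ d j : MvPolynomial σ R) ∈ 𝔪 ^ (q - offDeg j d) := by
    rw [add_pow]
    refine Ideal.sum_mem _ fun k hk => ?_
    by_cases hkm : m ≤ k
    · rw [← map_pow, pow_eq_zero_of_le hkm hyj, C_0, zero_mul, zero_mul]; exact zero_mem _
    · rw [not_le] at hkm
      refine Ideal.mul_mem_right _ _ (Ideal.mul_mem_left _ _ ?_)
      refine Ideal.pow_le_pow_right ?_ (Ideal.pow_mem_pow (hXmem j) _)
      -- `q - off ≤ d j - k` from `m (q - off) ≤ d j`, `k < m`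
      rcases Nat.eq_zero_or_pos (q - offDeg j d) with h0 | hpos
      · rw [h0]; exact Nat.zero_le _
      · have h1 : (k + 1) * (q - offDeg j d) ≤ d j := le_trans (Nat.mul_le_mul_right _ hkm) hd
        have h2 : k ≤ k * (q - offDeg j d) := Nat.le_mul_of_pos_right k hpos
        rw [Nat.succ_mul] at h1
        omega
  have h4 : MvPolynomial.map mk (taylor K (monomial d c)) ∈ 𝔪 ^ q := by
    rw [hT]
    refine Ideal.mul_mem_left _ _ ?_
    have hmem := Ideal.mul_mem_mul h3 h2
    rw [← pow_add] at hmem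
    exact Ideal.pow_le_pow_right (by omega) hmem
  -- read off the coefficient
  rw [mem_pow_idealOfVars_iff'] at h4
  have h5 := h4 δ hδ
  rw [coeff_map, ← hasseDeriv_apply] at h5
  exact Ideal.Quotient.eq_zero_iff_mem.mp h5

/-- **(L4a) ARC CONDITION ⇒ TOP IDEAL IN THE ARC IDEAL**: `ArcCond_j(q, m)(G) ⇒ topIdeal q G ≤ (y_j^m, y_{≠j})`.
CONSUMES: `q = p^e` and characteristic `p` (for the `q`-power monomials). [folklore] -/
theorem topIdeal_le_arcIdeal {p : ℕ} [Fact p.Prime] [CharP K p] (e : ℕ) (j : σ) (m : ℕ) {G : MvPolynomial σ K}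
    (hG : ArcCond j (p ^ e) m G) : topIdeal (p ^ e) G ≤ arcIdeal j m := by
  unfold topIdeal
  rw [Ideal.span_le]
  rintro _ ⟨δ, ⟨hδ0, hδq⟩, rfl⟩
  show hasseDeriv K δ G ∈ arcIdeal j m
  rw [G.as_sum, map_sum]
  refine Ideal.sum_mem _ fun d hd => ?_
  rcases hG d hd with hP | harc
  · have hQ : IsQPow (p ^ e) (monomial d (coeff d G) : MvPolynomial σ K) :=
      isQPow_monomial ((isPthPowerExponent_iff _ _).mp hP) _
    rw [hasseDeriv_eq_zero_of_isQPow hQ hδ0 hδq]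
    exact zero_mem _
  · exact hasseDeriv_monomial_mem_arcIdeal j harc _ hδq

/-- **(L4b) TRANSPORT OF THE TOP IDEAL UNDER A SUBSTITUTION**: `topIdeal q (f G) ≤ (topIdeal q G).map f` for
every `K`-algebra endomorphism `f` (Taylor's formula in any algebra: `taylor(f G) = Ψ(taylor G)` with
`Ψ : C a ↦ C (f a), u_i ↦ taylor(f y_i) − C(f y_i) ∈ (u)`).  CONSUMES: nothing (any field). [folklore] -/
theorem topIdeal_map_le (q : ℕ) (f : MvPolynomial σ K →ₐ[K] MvPolynomial σ K) (G : MvPolynomial σ K) :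
    topIdeal q (f G) ≤ (topIdeal q G).map (f : MvPolynomial σ K →+* MvPolynomial σ K) := by
  set Δ : σ → MvPolynomial σ (MvPolynomial σ K) := fun i => taylor K (f (X i)) - C (f (X i)) with hΔ
  set Ψ : MvPolynomial σ (MvPolynomial σ K) →+* MvPolynomial σ (MvPolynomial σ K) :=
    eval₂Hom (C.comp (f : MvPolynomial σ K →+* MvPolynomial σ K)) Δ with hΨ
  have key : taylor K (f G) = Ψ (taylor K G) := by
    have h : (taylor K (σ := σ)).toRingHom.comp (f : MvPolynomial σ K →+* MvPolynomial σ K)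
        = Ψ.comp (taylor K (σ := σ)).toRingHom := by
      refine MvPolynomial.ringHom_ext (fun r => ?_) (fun i => ?_)
      · show taylor K (f (C r)) = Ψ (taylor K (C r))
        rw [algHom_C, taylor_C, hΨ, eval₂Hom_C, RingHom.comp_apply, RingHom.coe_coe, algHom_C,
          MvPolynomial.algebraMap_eq, taylor_C]
      · show taylor K (f (X i)) = Ψ (taylor K (X i))
        rw [taylor_X, map_add, hΨ, eval₂Hom_C, eval₂Hom_X', RingHom.comp_apply]
        show _ = C (f (X i)) + (taylor K (f (X i)) - C (f (X i)))
        ring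
    exact RingHom.congr_fun h G
  unfold topIdeal
  rw [Ideal.span_le]
  rintro _ ⟨ε, ⟨hε0, hεq⟩, rfl⟩
  show hasseDeriv K ε (f G) ∈ _
  rw [hasseDeriv_apply, key, (taylor K G).as_sum, map_sum, coeff_sum]
  refine Ideal.sum_mem _ fun δ _ => ?_
  rw [hΨ, eval₂Hom_monomial, RingHom.comp_apply, coeff_C_mul]
  by_cases hδ0 : δ = 0
  · subst hδ0
    rw [Finsupp.prod_zero_index, MvPolynomial.coeff_one, if_neg (Ne.symm hε0), mul_zero]
    exact zero_mem _
  by_cases hδq : δ.degree < q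
  · refine Ideal.mul_mem_right _ _ (Ideal.mem_map_of_mem _ (Ideal.subset_span ⟨δ, ⟨hδ0, hδq⟩, ?_⟩))
    simp only [hasseDeriv_apply]
  · have hmem : (δ.prod fun n k => Δ n ^ k) ∈ idealOfVars σ (MvPolynomial σ K) ^ δ.degree := by
      rw [Finsupp.prod_fintype _ _ (fun i => pow_zero _), Finsupp.degree_eq_sum]
      exact prod_pow_mem_pow _ _ _ _ fun i _ => taylor_sub_C_mem_idealOfVars (σ := σ) (f (X i))
    rw [mem_pow_idealOfVars_iff'] at hmem
    rw [hmem ε (by omega), mul_zero]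
    exact zero_mem _

omit [DecidableEq σ] [Fintype σ] in
/-- A substitution without constant terms preserves the constant coefficient. [folklore] -/
theorem constantCoeff_aeval_eq (g : σ → MvPolynomial σ K) (hg : ∀ i, constantCoeff (g i) = 0)
    (G : MvPolynomial σ K) : constantCoeff (MvPolynomial.aeval g G) = constantCoeff G := by
  have h : (constantCoeff : MvPolynomial σ K →+* K).comp
      (MvPolynomial.aeval g).toRingHom = constantCoeff := by
    refine MvPolynomial.ringHom_ext (fun r => ?_) (fun i => ?_)
    · show constantCoeff (MvPolynomial.aeval g (C r)) = constantCoeff (C r)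
      rw [MvPolynomial.aeval_C, MvPolynomial.algebraMap_eq]
    · show constantCoeff (MvPolynomial.aeval g (X i)) = constantCoeff (X i)
      rw [MvPolynomial.aeval_X, hg i, constantCoeff_X]
  exact RingHom.congr_fun h G

/-- **(L4) THE ISOLATION LAW.**  An ISOLATED top locus is incompatible with arc conditions of every depth in
`j`-based frames: `IsolatedTop q F ∧ (∀ m ∃ r, ArcCond_j(q,m)(frame_j(r) F)) ⇒ False`.  Transport the top ideal
through the inverse frame, apply the frame, kill `y_i (i ≠ j)`, and read the coefficient of `y_j^N`.
CONSUMES: `W.isolated t` at ONE stage; `q = p^e`, characteristic `p`. [folklore] -/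
theorem isolation_law {p : ℕ} [Fact p.Prime] [CharP K p] (e : ℕ) (j : σ) {F : MvPolynomial σ K}
    (hiso : IsolatedTop (p ^ e) F)
    (harc : ∀ m, ∃ r : σ → K[X], (∀ i, (r i).coeff 0 = 0) ∧ ArcCond j (p ^ e) m (frame j r F)) : False := by
  set q := p ^ e with hq
  obtain ⟨N, g, hg0, hg⟩ := hiso
  obtain ⟨r, hr0, hA⟩ := harc (N + 1)
  set S : MvPolynomial σ K →ₐ[K] MvPolynomial σ K := frame j r with hS
  set S' : MvPolynomial σ K →ₐ[K] MvPolynomial σ K := frame j (-r) with hS'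
  have h1 : topIdeal q (S F) ≤ arcIdeal j (N + 1) := topIdeal_le_arcIdeal e j (N + 1) hA
  have h2 : topIdeal q F ≤ (arcIdeal j (N + 1)).map (S' : MvPolynomial σ K →+* MvPolynomial σ K) := by
    have := topIdeal_map_le q S' (S F)
    rw [hS', hS, frame_neg_frame] at this
    exact this.trans (Ideal.map_mono h1)
  have hSS' : (S : MvPolynomial σ K →+* MvPolynomial σ K).comp (S' : MvPolynomial σ K →+* MvPolynomial σ K)
      = RingHom.id _ := RingHom.ext fun x => frame_frame_neg j r x
  have h3 : S g * X j ^ N ∈ (arcIdeal j (N + 1) : Ideal (MvPolynomial σ K)) := by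
    have := Ideal.mem_map_of_mem (S : MvPolynomial σ K →+* MvPolynomial σ K) (h2 (hg j))
    rw [Ideal.map_map, hSS', Ideal.map_id] at this
    simpa only [RingHom.coe_coe, map_mul, map_pow, hS, frame_X_self] using this
  -- kill the variables `y_i`, `i ≠ j`
  set ε : MvPolynomial σ K →ₐ[K] MvPolynomial σ K := MvPolynomial.aeval fun i => if i = j then X j else 0 with hε
  have h4 : (arcIdeal j (N + 1)).map (ε : MvPolynomial σ K →+* MvPolynomial σ K) ≤ Ideal.span {X j ^ (N + 1)} := by
    rw [arcIdeal, Ideal.map_span, Ideal.span_le]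
    rintro _ ⟨x, hx, rfl⟩
    rcases hx with rfl | ⟨i, hi, rfl⟩
    · rw [RingHom.coe_coe, map_pow, hε, MvPolynomial.aeval_X, if_pos rfl]
      exact Ideal.subset_span rfl
    · rw [RingHom.coe_coe, hε, MvPolynomial.aeval_X, if_neg hi]
      exact zero_mem _
  have h5 : ε (S g) * X j ^ N ∈ Ideal.span {(X j ^ (N + 1) : MvPolynomial σ K)} := by
    have := h4 (Ideal.mem_map_of_mem (ε : MvPolynomial σ K →+* MvPolynomial σ K) h3)
    simpa only [RingHom.coe_coe, map_mul, map_pow, hε, MvPolynomial.aeval_X, eq_self_iff_true, ↓reduceIte]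
      using this
  obtain ⟨a, ha⟩ := Ideal.mem_span_singleton'.mp h5
  have hle : ¬ Finsupp.single j (N + 1) ≤ Finsupp.single j N := fun h => by
    have := Finsupp.le_def.mp h j
    rw [Finsupp.single_eq_same, Finsupp.single_eq_same] at this
    omega
  have h6 := congrArg (coeff (Finsupp.single j N)) ha
  simp only [X_pow_eq_monomial, coeff_mul_monomial', if_neg hle, le_refl, ↓reduceIte, tsub_self, mul_one] at h6
  have h7 : coeff 0 (ε (S g)) = constantCoeff g := by
    show constantCoeff (ε (S g)) = constantCoeff g
    rw [hε, constantCoeff_aeval_eq _ (fun i => by split_ifs <;> simp) (S g), hS, constantCoeff_frame j r hr0]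
  exact hg0 (h7 ▸ h6.symm)

end Isolation

end

end Summit.ResolutionOfSingularities.ResolutionOfSingularities.Theorems.FloorDescent
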